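import Mathlib.LinearAlgebra.Dimension.Localization
import Mathlib.LinearAlgebra.Dimension.Finite
import Mathlib.LinearAlgebra.Charpoly.BaseChange
import Mathlib.RingTheory.Norm.Basic
import HarnessLib

/-!
# Rank conversion along a finite free algebra: `d·t` `R`-independent elements of an `𝒪`-module
# give `t` `𝒪`-independent elements (cell `b2b-bsdres`; prover unit `b2b-bsdres-additive-p3`, gen 15)

HONEST FRAMING (run/shared/lean/b2b/bsd-rank1-residual/, verbatim in every file): the goal of the
cell is to DELETE the COMBINATION-SHAPED residual classes of the Birch–Swinnerton-Dyer formula for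
ALL analytic-rank `≤ 1` elliptic curves over `ℚ` — "full BSD formula for every rank `≤ 1` curve in
class `C`" assembled STRICTLY from published theorems — so that the rank-`≤ 1` remainder becomes
exactly the CONSTRUCTION-SHAPED classes, which are TYPED (missing-input `Prop`s), NOT attempted.
This is not "finishing BSD". THEOREMS ONLY (Mathlib-only linear algebra); no named fact; nothing
about any curve; nothing booked; no label changes.

Generic commutative algebra used by `Iwasawa/CyclotomicPrime.lean` (the passage from `ℤ_p`-ranks
to ranks over `𝒪 = Λ/(ξ_p) ≅ ℤ_p[ζ_p]` behind "`E(F) ⊗ ℚ_p` is isomorphic to `ρ^t`" in Greenberg,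
LNM 1716, §5 p. 132): for a commutative domain `R`, an `R`-algebra `𝒪` of `R`-rank `≤ d` (`d ≥ 1`)
whose nonzero elements divide nonzero scalars, and an `𝒪`-module `M` with `d·t` `R`-linearly
independent elements, `M` has `t` `𝒪`-linearly independent elements
(`exists_linearIndependent_of_rank_le`, induction on `t` by rank–nullity over `R`); and in a finite
free algebra over a domain which is a domain, every nonzero element divides a nonzero scalar
(`exists_dvd_algebraMap_of_ne_zero`, Cayley–Hamilton for the multiplication map, constant term
`± N(α)`).
-/

namespace Summit.BirchSwinnertonDyer.Rank1Residual.Iwasawa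

section RankConversion

universe w

variable {R : Type*} [CommRing R] [IsDomain R] {O : Type*} [CommRing O] [Algebra R O]

/-- A nonzero element of a finite free algebra `𝒪` over a domain that is itself a domain divides
a nonzero scalar: by Cayley–Hamilton `χ(α) = 0` for the characteristic polynomial `χ` of
multiplication by `α`, whose constant term is `± N(α) ≠ 0`. [folklore] -/
theorem exists_dvd_algebraMap_of_ne_zero [IsDomain O] [Module.Free R O] [Module.Finite R O]
    (α : O) (hα : α ≠ 0) : ∃ c : R, c ≠ 0 ∧ α ∣ algebraMap R O c := by
  set χ := (Algebra.lmul R O α).charpoly with hχ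
  have hroot : Polynomial.aeval α χ = 0 := Algebra.aeval_self_charpoly_lmul α
  refine ⟨χ.coeff 0, ?_, ?_⟩
  · intro h0
    have hdet : LinearMap.det (Algebra.lmul R O α) = 0 := by
      rw [LinearMap.det_eq_sign_charpoly_coeff, ← hχ, h0, mul_zero]
    exact ((Algebra.norm_ne_zero_iff (R := R)).mpr hα) (by rw [Algebra.norm_apply]; exact hdet)
  · obtain ⟨q, hq⟩ := Polynomial.X_dvd_sub_C (p := χ)
    have e : χ = Polynomial.X * q + Polynomial.C (χ.coeff 0) := by rw [← hq]; ring
    rw [e] at hroot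
    simp only [map_add, map_mul, Polynomial.aeval_X, Polynomial.aeval_C] at hroot
    exact ⟨-Polynomial.aeval α q, by linear_combination hroot⟩

/-- **Rank conversion.** Let `𝒪` be an `R`-algebra (`R` a domain) of `R`-rank `≤ d`, `1 ≤ d`,
whose nonzero elements divide nonzero scalars, and `M` an `𝒪`-module (with the compatible
`R`-structure) containing `d·t` elements linearly independent over `R`. Then `M` contains `t`
elements linearly independent over `𝒪`. (Induction on `t`: an `R`-independent element `z` is
`𝒪`-torsion-free; `rank_R 𝒪z ≤ d` and rank–nullity for `M ↠ M/𝒪z`; lift an `𝒪`-independent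
family of `M/𝒪z`.) For `𝒪 = Λ/(ξ_p)`, `R = ℤ_p`, `d = p − 1` this is the passage from
`ℤ_p`-ranks to `𝒪`-ranks behind "`E(F) ⊗ ℚ_p ≅ ρ^t`" in Greenberg, LNM 1716, p. 132.
[folklore] -/
theorem exists_linearIndependent_of_rank_le {d : ℕ} (hd1 : 1 ≤ d)
    (hd : Module.rank R O ≤ d)
    (hO : ∀ α : O, α ≠ 0 → ∃ c : R, c ≠ 0 ∧ α ∣ algebraMap R O c) (t : ℕ) :
    ∀ (M : Type w) [AddCommGroup M] [Module O M] [Module R M] [IsScalarTower R O M],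
      ((d * t : ℕ) : Cardinal) ≤ Module.rank R M →
        ∃ z : Fin t → M, LinearIndependent O z := by
  induction t with
  | zero =>
    intro M _ _ _ _ _
    exact ⟨fun i ↦ i.elim0, linearIndependent_empty_type⟩
  | succ t ih =>
    intro M _ _ _ _ hM
    -- one `R`-independent element `z`
    have h1 : ((1 : ℕ) : Cardinal) ≤ Module.rank R M := by
      refine le_trans ?_ hM
      exact_mod_cast (show 1 ≤ d * (t + 1) by nlinarith)
    obtain ⟨f, hf⟩ := exists_linearIndependent_of_le_rank h1
    set z := f 0 with hz
    have hzR : ∀ c : R, c • z = 0 → c = 0 := by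
      intro c hc
      have := (Fintype.linearIndependent_iff.mp hf) (fun _ ↦ c) (by
        rw [Fin.sum_univ_one]; exact hc) 0
      exact this
    -- `z` is `𝒪`-torsion-free
    have hzO : ∀ α : O, α • z = 0 → α = 0 := by
      intro α hα
      by_contra hα0
      obtain ⟨c, hc, β, hβ⟩ := hO α hα0
      apply hc
      apply hzR
      rw [← algebraMap_smul O c z, hβ, mul_comm, mul_smul, hα, smul_zero]
    -- `N = 𝒪 z`, of `R`-rank `≤ d`
    set N : Submodule O M := Submodule.span O {z} with hN
    have hNle : Module.rank R (N.restrictScalars R) ≤ d := by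
      let g : O →ₗ[R] N.restrictScalars R :=
        LinearMap.codRestrict (N.restrictScalars R)
          ((LinearMap.toSpanSingleton O M z).restrictScalars R) fun α ↦ by
            change α • z ∈ N
            exact Submodule.smul_mem _ _ (Submodule.mem_span_singleton_self z)
      have hg : Function.Surjective g := by
        rintro ⟨m, hm⟩
        obtain ⟨α, rfl⟩ := Submodule.mem_span_singleton.mp hm
        exact ⟨α, rfl⟩
      have h := LinearMap.lift_rank_le_of_surjective g hg
      have h' : Cardinal.lift.{w} (Module.rank R O) ≤ d := by
        rw [Cardinal.lift_le_nat_iff]; exact hd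
      exact Cardinal.lift_le_nat_iff.mp (h.trans h')
    -- rank–nullity: `d·t ≤ rank_R (M / N)`
    have hq : ((d * t : ℕ) : Cardinal) ≤ Module.rank R (M ⧸ N) := by
      rw [← (Submodule.Quotient.restrictScalarsEquiv R N).rank_eq]
      have hrn := Submodule.rank_quotient_add_rank (N.restrictScalars R)
      have h2 : ((d * t : ℕ) : Cardinal) + (d : Cardinal) ≤
          Module.rank R (M ⧸ N.restrictScalars R) + (d : Cardinal) := by
        calc ((d * t : ℕ) : Cardinal) + (d : Cardinal) = ((d * (t + 1) : ℕ) : Cardinal) := by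
              push_cast; ring
          _ ≤ Module.rank R M := hM
          _ = Module.rank R (M ⧸ N.restrictScalars R) + Module.rank R (N.restrictScalars R) :=
              hrn.symm
          _ ≤ Module.rank R (M ⧸ N.restrictScalars R) + (d : Cardinal) := by gcongr
      exact (Cardinal.add_nat_le_add_nat_iff d).mp h2
    -- induction hypothesis on `M / N`, then lift
    obtain ⟨zq, hzq⟩ := ih (M ⧸ N) hq
    choose zl hzl using fun i ↦ Submodule.Quotient.mk_surjective N (zq i)
    have hzl' : LinearIndependent O zl := by
      refine LinearIndependent.of_comp N.mkQ ?_
      have e : (N.mkQ : M → M ⧸ N) ∘ zl = zq := funext fun i ↦ hzl i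
      rwa [e]
    refine ⟨Fin.cons z zl, LinearIndependent.finCons' z zl hzl' fun α y hy hαy ↦ ?_⟩
    -- `α z + y = 0` with `y ∈ span zl`: reduce mod `N`
    obtain ⟨a, rfl⟩ := (Submodule.mem_span_range_iff_exists_fun O).mp hy
    have hmod : ∑ i, a i • zq i = 0 := by
      have h0 := congrArg (N.mkQ : M → M ⧸ N) hαy
      rw [map_add, map_zero, map_sum] at h0
      have hαz : N.mkQ (α • z) = 0 := by
        rw [Submodule.mkQ_apply, Submodule.Quotient.mk_eq_zero]
        exact Submodule.smul_mem _ _ (Submodule.mem_span_singleton_self z)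
      rw [hαz, zero_add] at h0
      simpa only [map_smul, Submodule.mkQ_apply, hzl] using h0
    have ha : ∀ i, a i = 0 := Fintype.linearIndependent_iff.mp hzq a hmod
    simp only [ha, zero_smul, Finset.sum_const_zero, add_zero] at hαy
    exact hzO α hαy

end RankConversion

end Summit.BirchSwinnertonDyer.Rank1Residual.Iwasawa
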